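import Summits.AnomalousDissipation.AnomalousDissipation.Statement
import Literature.Analysis.FluidPDE.SteadyNSLatticePersistenceDrift
import Literature.Analysis.FluidPDE.TorusClassicalLerayHopfProofs
import Literature.Analysis.FluidPDE.GalerkinEnergyBalanceLongTime
import Literature.Analysis.FunctionSpaces.TorusWeightedGalerkinCoefficients
import Literature.Analysis.FunctionSpaces.TorusVectorParseval
import Literature.Analysis.FunctionSpaces.TorusFourierCalculus
import Literature.Analysis.FunctionSpaces.TorusInverseLaplacian

/-!
# Lacunary shear designs: unidirectional forces and the shear symbol (solo soloist, blind mode)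

A **shear design** (`ShearDesign`) is a sequence of pairwise distinct, never antipodal lattice
modes `K n` in the plane `k₀ = 0` with real amplitudes `a n` of rapid decay. It defines the
smooth, divergence-free, mean-zero unidirectional force `f = Re ∑ₙ aₙ (e_{K n} + e_{-K n}) e₁`
(`ShearDesign.force`, with `𝓕 f = ShearDesign.forceCoeff` by the tree's `realSynth_spec`), i.e.
`f = f₁(x₂, x₃) e₁`. The **shear symbol** `σ_ν(k) = 4π²ν|k|² + 2πi (k·M)` (`shearSymbol`) is the
Fourier multiplier of `(M·∇) − νΔ`, the linear operator to which the steady Navier–Stokes system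
reduces on shear profiles drifting with momentum `M`; recorded here: `|σ_ν(k)|² = (4π²ν|k|²)² +
(2π k·M)²`, `σ_ν(-k) = conj σ_ν(k)`, `|σ_ν(k)| ≥ max(4π²ν, 2π|k·M|)` for `k ≠ 0`.

The laminar states `u = M + Re ∑ₖ σ_ν(k)⁻¹ F(k) e_k e₁`, their ν-uniform energy bound and their
enstrophy lower bound are in `SoloBlindShearStates`; the small-divisor application (a FIXED smooth
force with bounded-energy Leray–Hopf families whose enstrophy diverges along every vanishing
viscosity sequence — the first rung of the rate ladder below `Literature.Turb.ZerothLaw`) is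
`SoloBlindSmallDivisorRung`. [cite: DoeringFoias2002, §2]
-/

open MeasureTheory Filter Topology Set UnitAddTorus Function
open scoped ENNReal NNReal ComplexConjugate InnerProductSpace

noncomputable section

namespace Summit.AnomalousDissipation.AnomalousDissipation.Theorems

open Literature.Analysis.FunctionSpaces Literature.Analysis.FunctionSpaces.Torus
open Literature.Analysis.FunctionSpaces.EuclideanSpace
open Literature.Analysis.FluidPDE Literature.Analysis.FluidPDE.ScalarFourier
open Literature.Analysis.FluidPDE.SteadyLattice Literature.Analysis.FluidPDE.SteadyLatticeDrift

/-- The physical flat unit torus `T³` (local notation). -/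
local notation "𝕋³" => UnitAddTorus (Fin 3)
/-- Velocity values on `T³` (local notation). -/
local notation "E³" => EuclideanSpace ℝ (Fin 3)
/-- Complex coefficient vectors (local notation). -/
local notation "ℂ³" => EuclideanSpace ℂ (Fin 3)

/-! ### Shear designs and their scalar amplitude -/

/-- A **lacunary shear design**: pairwise distinct, never antipodal modes `K n` in the plane
`k₀ = 0`, with real amplitudes `a n` decaying faster than every power of `|K n|`. [folklore] -/
structure ShearDesign where
  /-- the modes -/
  K : ℕ → (Fin 3 → ℤ)
  /-- the (real) amplitudes -/
  a : ℕ → ℝ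
  K_injective : Injective K
  K_zero : ∀ n, K n 0 = 0
  K_ne_neg : ∀ n m, K n ≠ -K m
  decay : ∀ m : ℕ, Summable fun n => (1 + freqNormSq (K n)) ^ m * |a n|

namespace ShearDesign

variable (D : ShearDesign)

/-- The antipodal modes `n ↦ -K n`. [folklore] -/
def negK : ℕ → (Fin 3 → ℤ) := fun n => -D.K n

/-- Unfolding `negK`. -/
theorem negK_apply (n : ℕ) : D.negK n = -D.K n := rfl

/-- `n ↦ -K n` is injective. [folklore] -/
theorem negK_injective : Injective D.negK := fun _ _ h => D.K_injective (neg_injective h)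

/-- The modes are non-zero. [folklore] -/
theorem K_ne_zero (n : ℕ) : D.K n ≠ 0 := fun h => D.K_ne_neg n n (by rw [h, neg_zero])

/-- `-K n` is not a mode. -/
theorem not_exists_K_eq_negK (n : ℕ) : ¬∃ m, D.K m = -D.K n := fun ⟨m, hm⟩ => D.K_ne_neg m n hm

/-- The one-sided extension `a n` at `K n`, zero elsewhere. [folklore] -/
def ext : (Fin 3 → ℤ) → ℝ := extend D.K D.a 0

/-- `ext (K n) = a n`. -/
theorem ext_K (n : ℕ) : D.ext (D.K n) = D.a n := D.K_injective.extend_apply _ _ _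

/-- `ext` vanishes off the modes. -/
theorem ext_of_not {k : Fin 3 → ℤ} (h : ¬∃ n, D.K n = k) : D.ext k = 0 := by
  rw [ext, extend_apply' _ _ _ h, Pi.zero_apply]

/-- `ext (-K n) = 0`. -/
theorem ext_negK (n : ℕ) : D.ext (-D.K n) = 0 := D.ext_of_not (D.not_exists_K_eq_negK n)

/-- The scalar amplitude `φ(k) = ext k + ext (-k)`: `a n` at `±K n`, zero elsewhere. [folklore] -/
def amp : (Fin 3 → ℤ) → ℝ := fun k => D.ext k + D.ext (-k)

/-- `φ(K n) = a n`. [folklore] -/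
theorem amp_K (n : ℕ) : D.amp (D.K n) = D.a n := by rw [amp, ext_K, ext_negK, add_zero]

/-- `φ(-K n) = a n`. [folklore] -/
theorem amp_negK (n : ℕ) : D.amp (-D.K n) = D.a n := by rw [amp, neg_neg, ext_negK, ext_K, zero_add]

/-- `φ` is even. [folklore] -/
theorem amp_neg (k : Fin 3 → ℤ) : D.amp (-k) = D.amp k := by rw [amp, amp, neg_neg, add_comm]

/-- Trichotomy of a frequency with respect to the design. [folklore] -/
theorem trichotomy (k : Fin 3 → ℤ) :
    (∃ n, k = D.K n) ∨ (∃ n, k = -D.K n) ∨ (D.ext k = 0 ∧ D.ext (-k) = 0) := by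
  by_cases h₁ : ∃ n, D.K n = k
  · obtain ⟨n, rfl⟩ := h₁; exact Or.inl ⟨n, rfl⟩
  by_cases h₂ : ∃ n, D.K n = -k
  · obtain ⟨n, hn⟩ := h₂; exact Or.inr (Or.inl ⟨n, by rw [hn, neg_neg]⟩)
  exact Or.inr (Or.inr ⟨D.ext_of_not h₁, D.ext_of_not h₂⟩)

/-- `φ` is supported in the plane `k₀ = 0`. [folklore] -/
theorem amp_eq_zero_of_apply_zero_ne {k : Fin 3 → ℤ} (hk : k 0 ≠ 0) : D.amp k = 0 := by
  rcases D.trichotomy k with ⟨n, rfl⟩ | ⟨n, rfl⟩ | ⟨h₁, h₂⟩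
  · exact absurd (D.K_zero n) hk
  · exact absurd (by rw [Pi.neg_apply, D.K_zero n, neg_zero]) hk
  · rw [amp, h₁, h₂, add_zero]

/-- `φ(0) = 0`. [folklore] -/
theorem amp_zero : D.amp 0 = 0 := by
  rcases D.trichotomy 0 with ⟨n, hn⟩ | ⟨n, hn⟩ | ⟨h₁, h₂⟩
  · exact absurd hn.symm (D.K_ne_zero n)
  · exact absurd (neg_eq_zero.1 hn.symm) (D.K_ne_zero n)
  · rw [amp, h₁, h₂, add_zero]

/-- `|φ(k)| ≤ |ext k| + |ext (-k)|`. -/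
theorem abs_amp_le (k : Fin 3 → ℤ) : |D.amp k| ≤ |D.ext k| + |D.ext (-k)| := abs_add_le _ _

/-- A weighted one-sided extension is the extension of the weighted amplitudes. -/
theorem mul_ext_eq (w : (Fin 3 → ℤ) → ℝ) :
    (fun k => w k * D.ext k) = extend D.K (fun n => w (D.K n) * D.a n) 0 := by
  funext k
  by_cases hk : ∃ n, D.K n = k
  · obtain ⟨n, rfl⟩ := hk
    rw [D.K_injective.extend_apply, ext_K]
  · rw [extend_apply' _ _ _ hk, D.ext_of_not hk, Pi.zero_apply, mul_zero]

/-- The reflected weighted extension is the extension along `-K` of the weighted amplitudes. -/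
theorem mul_ext_neg_eq (w : (Fin 3 → ℤ) → ℝ) :
    (fun k => w k * D.ext (-k)) = extend D.negK (fun n => w (-D.K n) * D.a n) 0 := by
  funext k
  by_cases hk : ∃ n, D.negK n = k
  · obtain ⟨n, rfl⟩ := hk
    rw [D.negK_injective.extend_apply, negK_apply, neg_neg, ext_K]
  · have hk' : ¬∃ n, D.K n = -k := fun ⟨n, hn⟩ => hk ⟨n, by rw [negK_apply, hn, neg_neg]⟩
    rw [extend_apply' _ _ _ hk, D.ext_of_not hk', Pi.zero_apply, mul_zero]

/-! ### The force -/

/-- The direction `e₁ ∈ ℂ³`. -/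
def e0 : ℂ³ := EuclideanSpace.single 0 1

/-- Coordinates of `e₁`. -/
theorem e0_apply (j : Fin 3) : e0 j = if j = 0 then 1 else 0 := by
  simp [e0]

/-- `‖e₁‖ = 1`. -/
theorem norm_e0 : ‖e0‖ = 1 := by simp [e0]

/-- `e₁` is a real vector. -/
theorem conjVec_e0 : conjVec e0 = e0 := by
  ext j; simp [conjVec_apply, e0_apply, apply_ite]

/-- The Fourier coefficients `F(k) = φ(k) e₁` of the force. [folklore] -/
def forceCoeff : (Fin 3 → ℤ) → ℂ³ := fun k => ((D.amp k : ℝ) : ℂ) • e0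

/-- Coordinates of `F(k)`. -/
theorem forceCoeff_apply (k : Fin 3 → ℤ) (j : Fin 3) :
    D.forceCoeff k j = if j = 0 then ((D.amp k : ℝ) : ℂ) else 0 := by
  simp [forceCoeff, e0_apply]

/-- `‖F(k)‖ = |φ(k)|`. -/
theorem norm_forceCoeff (k : Fin 3 → ℤ) : ‖D.forceCoeff k‖ = |D.amp k| := by
  rw [forceCoeff, norm_smul, norm_e0, mul_one, Complex.norm_real, Real.norm_eq_abs]

/-- `F(0) = 0`. -/
theorem forceCoeff_zero : D.forceCoeff 0 = 0 := by
  rw [forceCoeff, amp_zero, Complex.ofReal_zero, zero_smul]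

/-- `F(-k) = F(k)`. -/
theorem forceCoeff_neg (k : Fin 3 → ℤ) : D.forceCoeff (-k) = D.forceCoeff k := by
  rw [forceCoeff, forceCoeff, amp_neg]

/-- The force coefficients are conjugate symmetric (the force is real). [folklore] -/
theorem isConjSymm_forceCoeff : IsConjSymm D.forceCoeff := fun k => by
  rw [forceCoeff_neg, forceCoeff, conjVec_smul, Complex.conj_ofReal, conjVec_e0]

/-- The force coefficients are transversal (`k · F(k) = 0`): the force is divergence free. [folklore] -/
theorem forceCoeff_transversal (k : Fin 3 → ℤ) :
    (∑ j : Fin 3, ((k j : ℤ) : ℂ) * D.forceCoeff k j) = 0 := by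
  simp only [forceCoeff_apply, mul_ite, mul_zero, Finset.sum_ite_eq', Finset.mem_univ, if_true]
  by_cases hk : k 0 = 0
  · rw [hk, Int.cast_zero, zero_mul]
  · rw [D.amp_eq_zero_of_apply_zero_ne hk, Complex.ofReal_zero, mul_zero]

/-- The force coefficients decay rapidly. [folklore] -/
theorem rapidDecay_forceCoeff : RapidDecay D.forceCoeff := by
  intro m
  have h1 : Summable fun k => (1 + freqNormSq k) ^ m * |D.ext k| := by
    have heq : (fun k => (1 + freqNormSq k) ^ m * |D.ext k|) =
        extend D.K (fun n => (1 + freqNormSq (D.K n)) ^ m * |D.a n|) 0 := by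
      funext k
      by_cases h : ∃ n, D.K n = k
      · obtain ⟨n, rfl⟩ := h
        rw [D.K_injective.extend_apply, ext_K]
      · rw [extend_apply' _ _ _ h, D.ext_of_not h, Pi.zero_apply, abs_zero, mul_zero]
    rw [heq, summable_extend_zero D.K_injective]
    exact D.decay m
  have h2 : Summable fun k => (1 + freqNormSq k) ^ m * |D.ext (-k)| := by
    have heq : (fun k => (1 + freqNormSq k) ^ m * |D.ext (-k)|) =
        extend D.negK (fun n => (1 + freqNormSq (D.K n)) ^ m * |D.a n|) 0 := by
      funext k
      by_cases h : ∃ n, D.negK n = k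
      · obtain ⟨n, rfl⟩ := h
        rw [D.negK_injective.extend_apply, negK_apply, neg_neg, ext_K, freqNormSq_neg]
      · have h' : ¬∃ n, D.K n = -k := fun ⟨n, hn⟩ => h ⟨n, by rw [negK_apply, hn, neg_neg]⟩
        rw [extend_apply' _ _ _ h, D.ext_of_not h', Pi.zero_apply, abs_zero, mul_zero]
    rw [heq, summable_extend_zero D.negK_injective]
    exact D.decay m
  refine (h1.add h2).of_nonneg_of_le
    (fun k => mul_nonneg (one_add_freqNormSq_pow_nonneg k m) (norm_nonneg _)) fun k => ?_
  rw [norm_forceCoeff, ← mul_add]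
  exact mul_le_mul_of_nonneg_left (D.abs_amp_le k) (one_add_freqNormSq_pow_nonneg k m)

/-- **The force of a shear design**: `f = Re F_F`, a smooth real field with `𝓕 f = F`. [folklore] -/
def force : 𝕋³ → E³ := fun y => realPart (fourierSynth D.forceCoeff y)

/-- The force is smooth and has the designed Fourier coefficients. [folklore] -/
theorem force_spec : IsSmooth D.force ∧ (complexify ∘ D.force) = fourierSynth D.forceCoeff ∧
    mFourierCoeff (complexify ∘ D.force) = D.forceCoeff :=
  realSynth_spec D.rapidDecay_forceCoeff D.isConjSymm_forceCoeff

/-- The force is smooth. -/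
theorem isSmooth_force : IsSmooth D.force := D.force_spec.1

/-- `𝓕 f = F`. -/
theorem mFourierCoeff_force : mFourierCoeff (complexify ∘ D.force) = D.forceCoeff := D.force_spec.2.2

/-- The force is divergence free. [folklore] -/
theorem isDivFree_force : IsDivFree D.force :=
  isDivFree_of_sum_mul_mFourierCoeff_eq_zero D.isSmooth_force fun k => by
    rw [mFourierCoeff_force]; exact D.forceCoeff_transversal k

/-- The force has zero mean. [folklore] -/
theorem hasZeroMean_force : HasZeroMean D.force :=
  Literature.Analysis.FunctionSpaces.Torus.hasZeroMean_of_mFourierCoeff_zero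
    (by rw [mFourierCoeff_force]; exact D.forceCoeff_zero)

end ShearDesign

/-! ### The shear symbol -/

/-- The real pairing `k · M`. -/
def kdot (k : Fin 3 → ℤ) (M : E³) : ℝ := ∑ j : Fin 3, (k j : ℝ) * M j

/-- `(-k) · M = -(k · M)`. -/
theorem kdot_neg_left (k : Fin 3 → ℤ) (M : E³) : kdot (-k) M = -kdot k M := by
  simp [kdot, Finset.sum_neg_distrib]

/-- The complex pairing with `complexify M` is the real pairing. -/
theorem sum_intCast_mul_complexify (k : Fin 3 → ℤ) (M : E³) :
    (∑ j : Fin 3, ((k j : ℤ) : ℂ) * complexify M j) = ((kdot k M : ℝ) : ℂ) := by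
  simp only [kdot, complexify_apply, Complex.ofReal_sum, Complex.ofReal_mul, Complex.ofReal_intCast]

/-- **The shear symbol** `σ_ν(k) = 4π²ν|k|² + 2πi (k·M)` of `(M·∇) − νΔ` on the mode `k`. [folklore] -/
def shearSymbol (ν : ℝ) (M : E³) (k : Fin 3 → ℤ) : ℂ :=
  ⟨ν * (4 * Real.pi ^ 2 * freqNormSq k), 2 * Real.pi * kdot k M⟩

/-- Real part of the shear symbol. -/
theorem shearSymbol_re (ν : ℝ) (M : E³) (k : Fin 3 → ℤ) :
    (shearSymbol ν M k).re = ν * (4 * Real.pi ^ 2 * freqNormSq k) := rfl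

/-- Imaginary part of the shear symbol. -/
theorem shearSymbol_im (ν : ℝ) (M : E³) (k : Fin 3 → ℤ) :
    (shearSymbol ν M k).im = 2 * Real.pi * kdot k M := rfl

/-- The shear symbol in the form `4π²ν|k|² + 2πi (k·M)`. [folklore] -/
theorem shearSymbol_eq (ν : ℝ) (M : E³) (k : Fin 3 → ℤ) :
    shearSymbol ν M k = ((ν * (4 * Real.pi ^ 2 * freqNormSq k) : ℝ) : ℂ) +
      2 * Real.pi * Complex.I * ((kdot k M : ℝ) : ℂ) := by
  rw [shearSymbol, Complex.mk_eq_add_mul_I]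
  push_cast
  ring

/-- `|σ_ν(k)|² = (4π²ν|k|²)² + (2π k·M)²`. [folklore] -/
theorem norm_sq_shearSymbol (ν : ℝ) (M : E³) (k : Fin 3 → ℤ) :
    ‖shearSymbol ν M k‖ ^ 2 =
      (ν * (4 * Real.pi ^ 2 * freqNormSq k)) ^ 2 + (2 * Real.pi * kdot k M) ^ 2 := by
  rw [Complex.sq_norm, shearSymbol, Complex.normSq_mk]
  ring

/-- `σ_ν(-k) = conj σ_ν(k)`. [folklore] -/
theorem shearSymbol_neg (ν : ℝ) (M : E³) (k : Fin 3 → ℤ) :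
    shearSymbol ν M (-k) = conj (shearSymbol ν M k) := by
  apply Complex.ext
  · rw [shearSymbol_re, Complex.conj_re, shearSymbol_re, freqNormSq_neg]
  · rw [shearSymbol_im, Complex.conj_im, shearSymbol_im, kdot_neg_left, mul_neg]

/-- `(2π k·M)² ≤ |σ_ν(k)|²`. [folklore] -/
theorem sq_kdot_le_norm_sq_shearSymbol (ν : ℝ) (M : E³) (k : Fin 3 → ℤ) :
    (2 * Real.pi * kdot k M) ^ 2 ≤ ‖shearSymbol ν M k‖ ^ 2 := by
  rw [norm_sq_shearSymbol]; nlinarith [sq_nonneg (ν * (4 * Real.pi ^ 2 * freqNormSq k))]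

/-- `4π²ν ≤ |σ_ν(k)|` for `k ≠ 0`, `ν ≥ 0`. [folklore] -/
theorem norm_shearSymbol_ge {ν : ℝ} (hν : 0 ≤ ν) (M : E³) {k : Fin 3 → ℤ} (hk : k ≠ 0) :
    ν * (4 * Real.pi ^ 2) ≤ ‖shearSymbol ν M k‖ := by
  have h1 : ν * (4 * Real.pi ^ 2) ≤ ν * (4 * Real.pi ^ 2 * freqNormSq k) :=
    mul_le_mul_of_nonneg_left
      (le_mul_of_one_le_right (by positivity) (one_le_freqNormSq_of_ne_zero hk)) hν
  refine h1.trans ?_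
  calc ν * (4 * Real.pi ^ 2 * freqNormSq k) = |(shearSymbol ν M k).re| := by
        rw [shearSymbol_re, abs_of_nonneg (mul_nonneg hν (mul_nonneg (by positivity) (freqNormSq_nonneg k)))]
    _ ≤ ‖shearSymbol ν M k‖ := Complex.abs_re_le_norm _

/-- `σ_ν(k) ≠ 0` for `ν > 0`, `k ≠ 0`. [folklore] -/
theorem shearSymbol_ne_zero {ν : ℝ} (hν : 0 < ν) (M : E³) {k : Fin 3 → ℤ} (hk : k ≠ 0) :
    shearSymbol ν M k ≠ 0 := by
  intro h
  have := norm_shearSymbol_ge hν.le M hk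
  rw [h, norm_zero] at this
  linarith [mul_pos hν (by positivity : (0 : ℝ) < 4 * Real.pi ^ 2)]

end Summit.AnomalousDissipation.AnomalousDissipation.Theorems

end
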